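import Mathlib.FieldTheory.IsAlgClosed.Basic
import Mathlib.Algebra.Polynomial.Inductions
import Mathlib.LinearAlgebra.FiniteDimensional.Lemmas
import Mathlib.LinearAlgebra.Quotient.Basic
import Mathlib.LinearAlgebra.Dimension.Finite
import HarnessLib

/-!
# Lang's theorem for Frobenius-semilinear maps (vector-space form)

Let `k` be an algebraically closed field, `q ≥ 2`, `σ : k →+* k` the map `x ↦ x ^ q` (so
`char k = p > 0` and `q` is a power of `p`), `V` a finite-dimensional `k`-vector space and
`Ψ : V → V` an injective `σ`-semilinear map (`Ψ (c • v) = c ^ q • Ψ v`). This file proves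

* `Literature.NumberTheory.GaloisRepresentations.FrobeniusSemilinear.exists_basis_forall_apply_eq` —
  **`V` has a basis of `Ψ`-fixed vectors** (equivalently `k̄ ⊗_{𝔽_q} V^{Ψ=1} ≅ V`; Lang's
  theorem `H¹(𝔽_q, GL_n) = 1` / "Lang–Steinberg" in its linear-algebra form: Katz,
  *p-adic properties of modular schemes and modular forms* (1973), Prop. 4.1.1; SGA 7 XXII 1.1;
  Fontaine–Ouyang, *Theory of p-adic Galois representations*, Prop. 3.6 ("unit-root
  `φ`-modules over an algebraically closed field are trivial"));
* `…FrobeniusSemilinear.surjective_sub` — **`v ↦ v - Ψ v` is surjective** (additive form,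
  Artin–Schreier).

These are the residue-field inputs of Lang's theorem over a complete discrete valuation ring
with algebraically closed residue field (`X = G · φ(X)` is solvable in `GL_N`), used for the
`K̂^nr`-admissibility of unramified `p`-adic Galois representations (Fontaine, *Représentations
p-adiques des corps locaux* (1990), A1.2; Serre, *Local Fields*, XIII §5 / Lang's theorem).

## Proof (elementary, as formalised)

Fixed vector: take `u ≠ 0` and the first `m` with `Ψᵐ u ∈ span(u, Ψu, …, Ψᵐ⁻¹u)`, say
`Ψᵐ u = ∑ aᵢ Ψⁱ u`. For `v = ∑ cᵢ Ψⁱ u` one has `Ψ v = v` iff `c₀ = a₀ c_{m-1}^q`,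
`c_{i+1} = cᵢ^q + a_{i+1} c_{m-1}^q`; putting `s = c_{m-1}^q` the `cᵢ = Cᵢ(s)` are polynomials in
`s` (`langPoly`) and the condition becomes `C_{m-1}(s)^q = s`, a polynomial equation
`Q(s) = 0` with `Q(0) = 0`, `Q'(0) = -1`, `deg Q ≥ 2`; so `Q/X` has a root `s₀ ≠ 0`, giving a
non-zero fixed `v` (`exists_ne_zero_apply_eq`). Basis: induct on `dim V` through `V/kv`
(`Ψ` descends, stays injective because `σ` is onto), lift a fixed basis of the quotient and
correct each lift `w` (`Ψ w = w + c v`) by `x v` with `x^q - x + c = 0`. Surjectivity of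
`1 - Ψ`: in a fixed basis it is `xᵢ ↦ xᵢ - xᵢ^q` coordinatewise.

No new definitions besides the auxiliary polynomials `langPoly`; no named facts.

## References

* N. Katz, *p-adic properties of modular schemes and modular forms*, LNM 350 (1973), Prop. 4.1.1.
* J.-M. Fontaine, Y. Ouyang, *Theory of p-adic Galois representations* (Springer draft), §3.2.
* J.-P. Serre, *Local Fields*, GTM 67, Ch. XIII §5 (Lang's theorem). [SerreLocalFields1979]
-/

noncomputable section

open Polynomial Module Submodule

namespace Literature.NumberTheory.GaloisRepresentations

namespace FrobeniusSemilinear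

/-! ### The auxiliary polynomials `Cᵢ` -/

section Poly

variable {k : Type*} [Field k]

/-- The polynomials `C₀ = a₀ X`, `C_{i+1} = Cᵢ ^ q + a_{i+1} X` parametrising the candidate fixed
vectors `∑ Cᵢ(s) Ψⁱ u` of a `q`-semilinear map on the cyclic subspace generated by `u`
(`Ψᵐ u = ∑ aᵢ Ψⁱ u`). [folklore] -/
def langPoly (a : ℕ → k) (q : ℕ) : ℕ → k[X]
  | 0 => C (a 0) * X
  | i + 1 => langPoly a q i ^ q + C (a (i + 1)) * X

/-- Unfolding lemma: `C₀ = a₀ X`. [folklore] -/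
@[simp] lemma langPoly_zero (a : ℕ → k) (q : ℕ) : langPoly a q 0 = C (a 0) * X := rfl

/-- Unfolding lemma: `C_{i+1} = Cᵢ ^ q + a_{i+1} X`. [folklore] -/
@[simp] lemma langPoly_succ (a : ℕ → k) (q : ℕ) (i : ℕ) :
    langPoly a q (i + 1) = langPoly a q i ^ q + C (a (i + 1)) * X := rfl

/-- `C₀(s) = a₀ s`. [folklore] -/
lemma eval_langPoly_zero (a : ℕ → k) (q : ℕ) (s : k) : (langPoly a q 0).eval s = a 0 * s := by
  simp

/-- `C_{i+1}(s) = Cᵢ(s)^q + a_{i+1} s`. [folklore] -/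
lemma eval_langPoly_succ (a : ℕ → k) (q : ℕ) (i : ℕ) (s : k) :
    (langPoly a q (i + 1)).eval s = ((langPoly a q i).eval s) ^ q + a (i + 1) * s := by
  simp [eval_pow]

/-- `Cᵢ(0) = 0`. [folklore] -/
lemma eval_zero_langPoly (a : ℕ → k) {q : ℕ} (hq : q ≠ 0) (i : ℕ) :
    (langPoly a q i).eval 0 = 0 := by
  induction i with
  | zero => simp
  | succ i ih => simp [eval_pow, ih, zero_pow hq]

/-- `Cᵢ` has no constant term. [folklore] -/
lemma coeff_zero_langPoly (a : ℕ → k) {q : ℕ} (hq : q ≠ 0) (i : ℕ) :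
    (langPoly a q i).coeff 0 = 0 := by
  rw [coeff_zero_eq_eval_zero, eval_zero_langPoly a hq]

/-- The `q`-th power (`q ≥ 2`) of a polynomial without constant term has no linear term.
[folklore] -/
lemma coeff_one_pow_eq_zero {f : k[X]} (hf : f.coeff 0 = 0) {q : ℕ} (hq : 2 ≤ q) :
    (f ^ q).coeff 1 = 0 := by
  obtain ⟨g, rfl⟩ := X_dvd_iff.2 hf
  rw [mul_pow, coeff_X_pow_mul']
  rw [if_neg (by omega)]

/-- The linear coefficient of `C_{i+1}` is `a_{i+1}` (for `q ≥ 2`). [folklore] -/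
lemma coeff_one_langPoly_succ (a : ℕ → k) {q : ℕ} (hq : 2 ≤ q) (i : ℕ) :
    (langPoly a q (i + 1)).coeff 1 = a (i + 1) := by
  rw [langPoly_succ, coeff_add, coeff_one_pow_eq_zero (coeff_zero_langPoly a (by omega) i) hq,
    coeff_C_mul_X, if_pos rfl, zero_add]

/-- Degree dichotomy: either `a₀ = ⋯ = aᵢ = 0` and `Cᵢ = 0`, or some `aⱼ ≠ 0` (`j ≤ i`) and
`Cᵢ` is non-constant. [folklore] -/
lemma langPoly_eq_zero_or_natDegree_pos (a : ℕ → k) {q : ℕ} (hq : 2 ≤ q) (i : ℕ) :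
    (langPoly a q i = 0 ∧ ∀ j ≤ i, a j = 0) ∨
      (0 < (langPoly a q i).natDegree ∧ ∃ j ≤ i, a j ≠ 0) := by
  induction i with
  | zero =>
    by_cases h0 : a 0 = 0
    · left
      exact ⟨by simp [h0], fun j hj => by rwa [Nat.le_zero.1 hj]⟩
    · right
      exact ⟨by rw [langPoly_zero, natDegree_C_mul_X _ h0]; exact Nat.one_pos, 0, le_rfl, h0⟩
  | succ i ih =>
    rcases ih with ⟨hCi, hai⟩ | ⟨hCi, j, hj, haj⟩
    · by_cases hs : a (i + 1) = 0
      · left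
        refine ⟨by simp [hCi, hs, zero_pow (by omega : q ≠ 0)], fun j hj => ?_⟩
        rcases Nat.of_le_succ hj with hj' | rfl
        · exact hai j hj'
        · exact hs
      · right
        refine ⟨?_, i + 1, le_rfl, hs⟩
        rw [langPoly_succ, hCi, zero_pow (by omega : q ≠ 0), zero_add, natDegree_C_mul_X _ hs]
        exact Nat.one_pos
    · right
      refine ⟨?_, j, hj.trans (Nat.le_succ i), haj⟩
      have hpow : (langPoly a q i ^ q).natDegree = q * (langPoly a q i).natDegree :=
        natDegree_pow _ _
      have hlt : (C (a (i + 1)) * X).natDegree < (langPoly a q i ^ q).natDegree := by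
        refine (natDegree_C_mul_le (a (i + 1)) X).trans_lt ?_
        rw [natDegree_X, hpow]
        calc 1 < 2 * 1 := by norm_num
          _ ≤ q * (langPoly a q i).natDegree := Nat.mul_le_mul hq hCi
      rw [langPoly_succ, natDegree_add_eq_left_of_natDegree_lt hlt, hpow]
      exact Nat.mul_pos (by omega) hCi

end Poly

/-! ### A non-zero fixed vector -/

section Fixed

variable {k : Type*} [Field k] {q : ℕ} {σ : k →+* k}
  {V : Type*} [AddCommGroup V] [Module k V]

/-- **Key identity.** If `Ψᵐ u = ∑_{i<m} aᵢ Ψⁱ u` (and `aₘ = 0`), then for every `s`,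
`Ψ (∑_{i<m} Cᵢ(s) Ψⁱ u) = ∑_{i<m} Cᵢ(s) Ψⁱ u + (Cₘ(s) - s) Ψᵐ u`. [folklore] -/
lemma apply_sum_langPoly (hσ : ∀ x, σ x = x ^ q) (Ψ : V →ₛₗ[σ] V) (u : V) (m : ℕ)
    (a : ℕ → k) (ham : a m = 0)
    (he : (⇑Ψ)^[m] u = ∑ i ∈ Finset.range m, a i • (⇑Ψ)^[i] u) (s : k) :
    Ψ (∑ i ∈ Finset.range m, (langPoly a q i).eval s • (⇑Ψ)^[i] u) =
      (∑ i ∈ Finset.range m, (langPoly a q i).eval s • (⇑Ψ)^[i] u) +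
        ((langPoly a q m).eval s - s) • (⇑Ψ)^[m] u := by
  set e : ℕ → V := fun i => (⇑Ψ)^[i] u with he_def
  set c : ℕ → k := fun i => (langPoly a q i).eval s with hc_def
  have hΨe : ∀ i, Ψ (e i) = e (i + 1) := fun i => (Function.iterate_succ_apply' Ψ i u).symm
  have hc0 : c 0 = a 0 * s := eval_langPoly_zero a q s
  have hcs : ∀ i, c i ^ q = c (i + 1) - a (i + 1) * s := fun i => by
    simp only [hc_def, eval_langPoly_succ]; ring
  -- `Ψ v = ∑_{i<m} cᵢ^q e_{i+1}`
  have h1 : Ψ (∑ i ∈ Finset.range m, c i • e i) =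
      ∑ i ∈ Finset.range m, (c (i + 1) - a (i + 1) * s) • e (i + 1) := by
    rw [map_sum]
    refine Finset.sum_congr rfl fun i _ => ?_
    rw [LinearMap.map_smulₛₗ, hσ, hΨe, hcs]
  -- shift the two sums
  have h2 : ∑ i ∈ Finset.range m, c (i + 1) • e (i + 1) =
      (∑ i ∈ Finset.range m, c i • e i) + c m • e m - c 0 • e 0 := by
    have := Finset.sum_range_succ' (fun i => c i • e i) m
    rw [Finset.sum_range_succ] at this
    rw [eq_sub_iff_add_eq, ← this]
  have h3 : ∑ i ∈ Finset.range m, (a (i + 1) * s) • e (i + 1) = s • e m - (a 0 * s) • e 0 := by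
    have := Finset.sum_range_succ' (fun i => (a i * s) • e i) m
    rw [Finset.sum_range_succ, ham, zero_mul, zero_smul, add_zero] at this
    have hsum : ∑ i ∈ Finset.range m, (a i * s) • e i = s • e m := by
      have he' : e m = ∑ i ∈ Finset.range m, a i • e i := he
      rw [he', Finset.smul_sum]
      refine Finset.sum_congr rfl fun i _ => ?_
      rw [mul_comm, mul_smul]
    rw [eq_sub_iff_add_eq, ← this, hsum]
  calc Ψ (∑ i ∈ Finset.range m, c i • e i)
      = ∑ i ∈ Finset.range m, (c (i + 1) - a (i + 1) * s) • e (i + 1) := h1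
    _ = ∑ i ∈ Finset.range m, c (i + 1) • e (i + 1) -
          ∑ i ∈ Finset.range m, (a (i + 1) * s) • e (i + 1) := by
        rw [← Finset.sum_sub_distrib]
        refine Finset.sum_congr rfl fun i _ => ?_
        rw [sub_smul]
    _ = ((∑ i ∈ Finset.range m, c i • e i) + c m • e m - c 0 • e 0) -
          (s • e m - (a 0 * s) • e 0) := by rw [h2, h3]
    _ = (∑ i ∈ Finset.range m, c i • e i) + (c m - s) • e m := by
        rw [hc0, sub_smul]
        abel

variable [IsAlgClosed k]

/-- `x ↦ x ^ q` (`q ≥ 1`) is onto on an algebraically closed field. [folklore] -/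
lemma surjective_of_apply_eq_pow (hσ : ∀ x, σ x = x ^ q) (hq : 0 < q) :
    Function.Surjective σ := fun y => by
  obtain ⟨z, hz⟩ := IsAlgClosed.exists_pow_nat_eq y hq
  exact ⟨z, by rw [hσ, hz]⟩

/-- Artin–Schreier-type equations `x ^ q - x + c = 0` (`q ≥ 2`) are solvable in an
algebraically closed field. [folklore] -/
lemma exists_pow_sub_self_add_eq_zero (hq : 2 ≤ q) (c : k) : ∃ x : k, x ^ q - x + c = 0 := by
  have hdeg : (X ^ q - X + C c : k[X]).natDegree = q := by
    have hlt : (-X + C c : k[X]).natDegree < (X ^ q : k[X]).natDegree := by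
      rw [natDegree_X_pow]
      refine (natDegree_add_le _ _).trans_lt ?_
      rw [natDegree_neg, natDegree_X, natDegree_C, Nat.max_zero]
      omega
    rw [show (X ^ q - X + C c : k[X]) = X ^ q + (-X + C c) by ring,
      natDegree_add_eq_left_of_natDegree_lt hlt, natDegree_X_pow]
  have hne : (X ^ q - X + C c : k[X]) ≠ 0 := by
    intro h
    rw [h, natDegree_zero] at hdeg
    omega
  have hdeg' : (X ^ q - X + C c : k[X]).degree ≠ 0 := by
    rw [degree_eq_natDegree hne, hdeg]
    exact_mod_cast (show q ≠ 0 by omega)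
  obtain ⟨x, hx⟩ := IsAlgClosed.exists_root _ hdeg'
  refine ⟨x, ?_⟩
  simpa [eval_pow] using hx

variable [FiniteDimensional k V]

/-- **Existence of a non-zero fixed vector** of an injective `q`-semilinear endomorphism of a
non-zero finite-dimensional vector space over an algebraically closed field (`q ≥ 2`). This is
the heart of Lang's theorem for `GL_n` over `𝔽_q`. [cite: SerreLocalFields1979, Ch. XIII §5] -/
theorem exists_ne_zero_apply_eq [Nontrivial V] (hσ : ∀ x, σ x = x ^ q) (hq : 2 ≤ q)
    (Ψ : V →ₛₗ[σ] V) (hΨ : Function.Injective Ψ) : ∃ v : V, v ≠ 0 ∧ Ψ v = v := by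
  classical
  obtain ⟨u, hu⟩ := exists_ne (0 : V)
  set e : ℕ → V := fun i => (⇑Ψ)^[i] u with he_def
  have hΨe : ∀ i, Ψ (e i) = e (i + 1) := fun i => (Function.iterate_succ_apply' Ψ i u).symm
  -- the first `m` such that `e 0, …, e m` are dependent
  have hdep : ∃ m, ¬ LinearIndependent k (fun i : Fin (m + 1) => e i) := by
    refine ⟨finrank k V, fun hli => ?_⟩
    have := hli.fintype_card_le_finrank
    rw [Fintype.card_fin] at this
    omega
  let m := Nat.find hdep
  have hm : ¬ LinearIndependent k (fun i : Fin (m + 1) => e i) := Nat.find_spec hdep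
  have hli : LinearIndependent k (fun i : Fin m => e i) := by
    rcases Nat.eq_zero_or_pos m with h0 | hpos
    · have : IsEmpty (Fin m) := by rw [h0]; infer_instance
      exact linearIndependent_empty_type
    · have hmin := Nat.find_min hdep (show m - 1 < m by omega)
      rw [not_not] at hmin
      have hcast : m - 1 + 1 = m := Nat.sub_add_cancel hpos
      -- transport along `Fin (m - 1 + 1) = Fin m`
      have : (fun i : Fin m => e i) = (fun i : Fin (m - 1 + 1) => e i) ∘ Fin.cast hcast.symm := by
        funext i; rfl
      rw [this]
      exact hmin.comp _ (Fin.cast_injective _)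
  -- `e m ∈ span (e 0, …, e (m-1))`
  have hsnoc : (Fin.snoc (fun i : Fin m => e i) (e m) : Fin (m + 1) → V) =
      fun i : Fin (m + 1) => e i := by
    funext i
    refine Fin.lastCases ?_ (fun j => ?_) i
    · rw [Fin.snoc_last, Fin.val_last]
    · rw [Fin.snoc_castSucc, Fin.val_castSucc]
  have hmem : e m ∈ span k (Set.range fun i : Fin m => e i) := by
    by_contra hnot
    exact hm (hsnoc ▸ hli.finSnoc hnot)
  obtain ⟨af, haf⟩ := Submodule.mem_span_range_iff_exists_fun k |>.1 hmem
  -- extend the coefficients by zero to `ℕ`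
  let a : ℕ → k := fun i => if h : i < m then af ⟨i, h⟩ else 0
  have ham : a m = 0 := by simp [a]
  have ha_fin : ∀ i : Fin m, a i = af i := fun i => by simp [a, i.2]
  have he_sum : e m = ∑ i ∈ Finset.range m, a i • e i := by
    rw [Finset.sum_range (fun i => a i • e i), ← haf]
    exact Finset.sum_congr rfl fun i _ => by rw [ha_fin]
  -- `m ≥ 1` (as `e 0 = u ≠ 0`) and some `aⱼ ≠ 0` (as `e m ≠ 0`)
  have hem : e m ≠ 0 := by
    have hinj : Function.Injective ((⇑Ψ)^[m]) := Function.Injective.iterate hΨ m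
    have hz : ∀ n, (⇑Ψ)^[n] (0 : V) = 0 := fun n => by
      induction n with
      | zero => rfl
      | succ n ih => rw [Function.iterate_succ_apply', ih, map_zero]
    intro h0
    apply hu
    apply hinj
    change e m = (⇑Ψ)^[m] 0
    rw [h0, hz]
  have hmpos : 0 < m := by
    by_contra h0
    have h0' : m = 0 := by omega
    apply hem
    rw [he_sum, h0', Finset.range_zero, Finset.sum_empty]
  have haj : ∃ j ≤ m - 1, a j ≠ 0 := by
    by_contra hall
    push Not at hall
    apply hem
    rw [he_sum]
    refine Finset.sum_eq_zero fun i hi => ?_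
    rw [hall i (by have := Finset.mem_range.1 hi; omega), zero_smul]
  -- the polynomial `Q = Cₘ - X = C_{m-1}^q - X`
  have hCm : langPoly a q m = langPoly a q (m - 1) ^ q := by
    conv_lhs => rw [show m = m - 1 + 1 by omega, langPoly_succ]
    rw [show m - 1 + 1 = m by omega, ham, C_0, zero_mul, add_zero]
  have hdegC : 0 < (langPoly a q (m - 1)).natDegree := by
    rcases langPoly_eq_zero_or_natDegree_pos a hq (m - 1) with ⟨-, hall⟩ | ⟨hpos, -⟩
    · obtain ⟨j, hj, haj⟩ := haj
      exact absurd (hall j hj) haj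
    · exact hpos
  set Q : k[X] := langPoly a q m - X with hQ_def
  have hQdeg : 2 ≤ Q.natDegree := by
    have hpow : (langPoly a q m).natDegree = q * (langPoly a q (m - 1)).natDegree := by
      rw [hCm, natDegree_pow]
    have hge : 2 ≤ (langPoly a q m).natDegree := by
      rw [hpow]
      calc 2 = 2 * 1 := by norm_num
        _ ≤ q * (langPoly a q (m - 1)).natDegree := Nat.mul_le_mul hq hdegC
    have hlt : (X : k[X]).natDegree < (langPoly a q m).natDegree := by
      rw [natDegree_X]; omega
    rw [hQ_def, natDegree_sub_eq_left_of_natDegree_lt hlt]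
    exact hge
  have hQ0 : Q.coeff 0 = 0 := by
    rw [hQ_def, coeff_sub, coeff_zero_langPoly a (by omega) m, coeff_X_zero, sub_zero]
  have hQ1 : Q.coeff 1 = -1 := by
    rw [hQ_def, coeff_sub, show m = m - 1 + 1 by omega, coeff_one_langPoly_succ a hq,
      show m - 1 + 1 = m by omega, ham, coeff_X_one, zero_sub]
  -- `Q = Q₁ * X` with `Q₁(0) = -1`, `deg Q₁ ≥ 1`
  set Q₁ : k[X] := Q.divX with hQ₁_def
  have hQfac : Q₁ * X = Q := by
    have := divX_mul_X_add Q
    rwa [hQ0, C_0, add_zero] at this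
  have hQ₁deg : Q₁.degree ≠ 0 := by
    have hnat : Q₁.natDegree = Q.natDegree - 1 := natDegree_divX_eq_natDegree_tsub_one
    have hne : Q₁ ≠ 0 := by
      intro h
      have : Q₁.coeff 0 = 0 := by rw [h, coeff_zero]
      rw [hQ₁_def, coeff_divX, zero_add, hQ1] at this
      exact one_ne_zero (neg_eq_zero.1 this)
    rw [degree_eq_natDegree hne, hnat]
    exact_mod_cast (show Q.natDegree - 1 ≠ 0 by omega)
  obtain ⟨s₀, hs₀⟩ := IsAlgClosed.exists_root Q₁ hQ₁deg
  have hs₀ne : s₀ ≠ 0 := by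
    rintro rfl
    have h1 : Q₁.eval 0 = Q₁.coeff 0 := (coeff_zero_eq_eval_zero Q₁).symm
    rw [hs₀.eq_zero, hQ₁_def, coeff_divX, zero_add, hQ1] at h1
    exact one_ne_zero (neg_eq_zero.1 h1.symm)
  have hQs₀ : Q.eval s₀ = 0 := by
    rw [← hQfac, eval_mul, eval_X, hs₀.eq_zero, zero_mul]
  -- the fixed vector
  set v : V := ∑ i ∈ Finset.range m, (langPoly a q i).eval s₀ • e i with hv_def
  have hfix : Ψ v = v := by
    have := apply_sum_langPoly hσ Ψ u m a ham he_sum s₀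
    rw [← hv_def] at this
    rw [this]
    have h0 : (langPoly a q m).eval s₀ - s₀ = 0 := by
      have := hQs₀
      rwa [hQ_def, eval_sub, eval_X] at this
    rw [h0, zero_smul, add_zero]
  have hcm1 : (langPoly a q (m - 1)).eval s₀ ≠ 0 := by
    intro h0
    apply hs₀ne
    have := hQs₀
    rw [hQ_def, eval_sub, eval_X, hCm, eval_pow, h0, zero_pow (by omega : q ≠ 0),
      zero_sub, neg_eq_zero] at this
    exact this
  refine ⟨v, fun hv0 => hcm1 ?_, hfix⟩
  -- all coefficients of `v` vanish, in particular the `(m-1)`-st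
  have hsum : ∑ i : Fin m, (langPoly a q i).eval s₀ • e i = 0 := by
    rw [← Finset.sum_range (fun i => (langPoly a q i).eval s₀ • e i)]
    exact hv0
  have := Fintype.linearIndependent_iff.1 hli (fun i => (langPoly a q i).eval s₀) hsum
    ⟨m - 1, by omega⟩
  exact this

end Fixed

/-! ### Lang's theorem: a basis of fixed vectors -/

section Basis

universe u v

variable {k : Type v} [Field k] [IsAlgClosed k] {q : ℕ} {σ : k →+* k}

/-- Inductive step/packaging: every finite-dimensional `V` of dimension `d` has a `Ψ`-fixed basis
indexed by `Fin d`. [cite: SerreLocalFields1979, Ch. XIII §5] -/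
private theorem exists_basis_aux (hσ : ∀ x, σ x = x ^ q) (hq : 2 ≤ q) (d : ℕ) :
    ∀ {V : Type u} [AddCommGroup V] [Module k V] [FiniteDimensional k V] (Ψ : V →ₛₗ[σ] V),
      Function.Injective Ψ → finrank k V = d →
        ∃ b : Basis (Fin d) k V, ∀ i, Ψ (b i) = b i := by
  induction d with
  | zero =>
    intro V _ _ _ Ψ _ hd
    haveI : Subsingleton V := Module.finrank_zero_iff.1 hd
    exact ⟨Basis.empty _, fun i => i.elim0⟩
  | succ d ih =>
    intro V _ _ _ Ψ hΨ hd
    classical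
    haveI : Nontrivial V := Module.nontrivial_of_finrank_pos (R := k) (by omega)
    obtain ⟨v, hv, hΨv⟩ := exists_ne_zero_apply_eq hσ hq Ψ hΨ
    -- the line `p = k v` is `Ψ`-stable
    let p : Submodule k V := k ∙ v
    have hp : p ≤ p.comap Ψ := by
      intro x hx
      obtain ⟨c, rfl⟩ := mem_span_singleton.1 hx
      change Ψ (c • v) ∈ p
      rw [LinearMap.map_smulₛₗ, hΨv]
      exact smul_mem _ _ (mem_span_singleton_self v)
    let Ψ' : (V ⧸ p) →ₛₗ[σ] (V ⧸ p) := p.mapQ p Ψ hp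
    have hΨ' : Function.Injective Ψ' := by
      refine (injective_iff_map_eq_zero Ψ').2 fun x hx => ?_
      obtain ⟨x, rfl⟩ := Submodule.Quotient.mk_surjective p x
      rw [Submodule.mapQ_apply, Submodule.Quotient.mk_eq_zero] at hx
      obtain ⟨c, hc⟩ := mem_span_singleton.1 hx
      obtain ⟨c', rfl⟩ := surjective_of_apply_eq_pow hσ (by omega) c
      have hzero : Ψ (x - c' • v) = 0 := by
        rw [map_sub, LinearMap.map_smulₛₗ, hΨv, ← hc, sub_self]
      have hx0 : x - c' • v = 0 := hΨ (by rw [hzero, map_zero])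
      rw [Submodule.Quotient.mk_eq_zero, sub_eq_zero.1 hx0]
      exact smul_mem _ _ (mem_span_singleton_self v)
    have hdim : finrank k (V ⧸ p) = d := by
      have h1 := Submodule.finrank_quotient_add_finrank p
      have h2 : finrank k p = 1 := finrank_span_singleton hv
      omega
    obtain ⟨b', hb'⟩ := ih Ψ' hΨ' hdim
    -- lift the fixed basis of the quotient and correct the lifts
    choose w hw using fun i => Submodule.Quotient.mk_surjective p (b' i)
    have hc : ∀ i, ∃ c : k, c • v = Ψ (w i) - w i := fun i => by
      refine mem_span_singleton.1 ((Submodule.Quotient.eq p).1 ?_)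
      rw [← Submodule.mapQ_apply (h := hp), hw i]
      exact hb' i
    choose c hc using hc
    choose x hx using fun i => exists_pow_sub_self_add_eq_zero (k := k) hq (c i)
    let w' : Fin d → V := fun i => w i + x i • v
    have hfix : ∀ i, Ψ (w' i) = w' i := fun i => by
      have hσx : σ (x i) = x i - c i := by
        rw [hσ]
        have := hx i
        linear_combination this
      simp only [w', map_add, LinearMap.map_smulₛₗ, hΨv, hσx]
      rw [show Ψ (w i) = w i + c i • v by rw [hc i]; abel, sub_smul]
      abel
    have hmkw' : ∀ i, Submodule.Quotient.mk (p := p) (w' i) = b' i := fun i => by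
      simp only [w', Submodule.Quotient.mk_add, Submodule.Quotient.mk_smul, hw i]
      rw [(Submodule.Quotient.mk_eq_zero p).2 (mem_span_singleton_self v), smul_zero, add_zero]
    have hli' : LinearIndependent k w' := by
      have : LinearIndependent k (p.mkQ ∘ w') := by
        have heq : (p.mkQ ∘ w' : Fin d → V ⧸ p) = b' := funext fun i => hmkw' i
        rw [heq]
        exact b'.linearIndependent
      exact this.of_comp
    have hvnot : v ∉ span k (Set.range w') := by
      intro hmem
      obtain ⟨g, hg⟩ := (Submodule.mem_span_range_iff_exists_fun k).1 hmem
      have hg' : ∑ i, g i • b' i = 0 := by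
        have h1 : p.mkQ (∑ i, g i • w' i) = 0 := by
          rw [hg, mkQ_apply]
          exact (Submodule.Quotient.mk_eq_zero p).2 (mem_span_singleton_self v)
        rw [map_sum] at h1
        rw [← h1]
        refine Finset.sum_congr rfl fun i _ => ?_
        rw [map_smul, mkQ_apply, hmkw']
      have hg0 := Fintype.linearIndependent_iff.1 b'.linearIndependent g hg'
      apply hv
      rw [← hg]
      exact Finset.sum_eq_zero fun i _ => by rw [hg0 i, zero_smul]
    have hli : LinearIndependent k (Fin.cons v w' : Fin (d + 1) → V) := hli'.finCons hvnot
    have hcard : Fintype.card (Fin (d + 1)) = finrank k V := by rw [Fintype.card_fin, hd]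
    refine ⟨basisOfLinearIndependentOfCardEqFinrank hli hcard, fun i => ?_⟩
    rw [coe_basisOfLinearIndependentOfCardEqFinrank]
    refine Fin.cases ?_ (fun j => ?_) i
    · rw [Fin.cons_zero]; exact hΨv
    · rw [Fin.cons_succ]; exact hfix j

variable {V : Type u} [AddCommGroup V] [Module k V] [FiniteDimensional k V]

/-- **Lang's theorem (vector-space form).** An injective `q`-semilinear endomorphism
(`q ≥ 2`, `σ x = x ^ q`) of a finite-dimensional vector space over an algebraically closed field
admits a basis of fixed vectors: `V = k ⊗_{𝔽_q} V^{Ψ = 1}`. (Katz 1973, Prop. 4.1.1;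
Fontaine–Ouyang, Prop. 3.6; the case `GL_n` of Lang's theorem, Serre, *Local Fields* XIII §5
/ *Algebraic Groups and Class Fields* VI §4.) [cite: SerreLocalFields1979, Ch. XIII §5] -/
theorem exists_basis_forall_apply_eq (hσ : ∀ x, σ x = x ^ q) (hq : 2 ≤ q) (Ψ : V →ₛₗ[σ] V)
    (hΨ : Function.Injective Ψ) :
    ∃ b : Basis (Fin (finrank k V)) k V, ∀ i, Ψ (b i) = b i :=
  exists_basis_aux hσ hq (finrank k V) Ψ hΨ rfl

/-- **Additive Lang / Artin–Schreier:** for an injective `q`-semilinear `Ψ` (`q ≥ 2`) on a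
finite-dimensional space over an algebraically closed field, `v ↦ v - Ψ v` is surjective (in a
fixed basis it is `xᵢ ↦ xᵢ - xᵢ^q`). [cite: SerreLocalFields1979, Ch. XIII §5] -/
theorem surjective_sub (hσ : ∀ x, σ x = x ^ q) (hq : 2 ≤ q) (Ψ : V →ₛₗ[σ] V)
    (hΨ : Function.Injective Ψ) : Function.Surjective fun v => v - Ψ v := by
  intro w
  obtain ⟨b, hb⟩ := exists_basis_forall_apply_eq hσ hq Ψ hΨ
  -- solve `yᵢ - yᵢ^q = wᵢ` coordinatewise
  have hy : ∀ i, ∃ y : k, y - σ y = b.repr w i := fun i => by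
    obtain ⟨y, hy⟩ := exists_pow_sub_self_add_eq_zero (k := k) hq (b.repr w i)
    exact ⟨y, by rw [hσ]; linear_combination -hy⟩
  choose y hy using hy
  refine ⟨∑ i, y i • b i, ?_⟩
  change (∑ i, y i • b i) - Ψ (∑ i, y i • b i) = w
  rw [map_sum, ← Finset.sum_sub_distrib]
  conv_rhs => rw [← b.sum_repr w]
  refine Finset.sum_congr rfl fun i _ => ?_
  rw [LinearMap.map_smulₛₗ, hb i, ← sub_smul, hy i]

/-- The fixed vectors of `Ψ` span `V` over `k`. [cite: SerreLocalFields1979, Ch. XIII §5] -/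
theorem span_fixedPoints_eq_top (hσ : ∀ x, σ x = x ^ q) (hq : 2 ≤ q) (Ψ : V →ₛₗ[σ] V)
    (hΨ : Function.Injective Ψ) : span k {v : V | Ψ v = v} = ⊤ := by
  obtain ⟨b, hb⟩ := exists_basis_forall_apply_eq hσ hq Ψ hΨ
  refine eq_top_iff.2 ((b.span_eq.symm.le).trans (span_mono ?_))
  rintro _ ⟨i, rfl⟩
  exact hb i

end Basis

end FrobeniusSemilinear

end Literature.NumberTheory.GaloisRepresentations

end
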